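import Literature.MathematicalPhysics.QuantumFieldTheory.Balaban1983to89.B9Cor35CDirPaddedCarrier

/-!
# `Balaban1983to89.B9Cor35CDirWordAtField` — [Balaban1985BackgroundPropagators] (3.21)∕(3.25) p. 394, p. 409 l. 1–5: THE DIRICHLET BLOCK WORD
# `Q′_□(Ṽ)G′_□(Ṽ)²Q′*_□(Ṽ)` ON THE CARRIER `𝔖 × ι` AT ANY FIELD `Ṽ` — the padding `1 − Ω₀` of the padded site inverse `(padΔ_{□,Ω₀}(Ṽ))⁻¹ = G′_□(Ṽ) + (1 − Ω₀)`
# is invisible from the blocks inside `Ω₀(□)`, so `QcR Ṽ ∘ (conj b(η²(padΔ(Ṽ))⁻¹))² ∘ QcsR Ṽ = conj b (η⁴·(res♯ ∘ X_□(Ṽ) ∘ ext♯)|_ℝ)` with def-Y's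
# `X_□(Ṽ) = XCubeGY i □ 𝔭 (GpDirY … Ω₀(□)) Ṽ` (FILE `B9Cor35CDirCarrierAtOne.word_one` at a general field; ROAD (I) U6b-iv part 2; seat dag-n06-c g33)

statement-level skeleton of published theorems with citation tags; proofs where landed; nothing here is a claim about the Yang–Mills mass gap

## What this file does (mathematically)

Theorem 3.4's `C`-step at the Dirichlet letter (FILE `B9Cor35CDirEngineAtCarrier.cor35_CDir_carrier`) produces the inverse of
`QcR Ṽ ∘ (Gext·Gext) ∘ QcsR Ṽ` with `Gext` the engine's `G`-word, identified by n06-a's `B9Cor36GpDirExtAtField.GextDirK_eq_GpDirVK` with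
`conj b(η²·(padΔ_{□,Ω₀}(Ṽ))⁻¹)` once `padΔ_{□,Ω₀}(Ṽ)` is a unit.  This file shows that, for ANY field `Ṽ` with `padΔ_{□,Ω₀}(Ṽ)` a unit,
* §1 `Ring.inverse (padΔ_{□,Ω₀}(Ṽ)) = G′_□(Ṽ) + (1 − Ω₀)` (`G′_□(Ṽ) = GpDirY … Ω₀(□) Ṽ = Ω₀(padΔ)⁻¹Ω₀`; the padded operator commutes with `Ω₀` and fixes
  the range of `1 − Ω₀`) — ★ `ringInverse_padDeltaCubeY_eq_add`;
* §2 the knit-cube averaging letters only see `Ω₀(□)` from the carrier: `res♯ ∘ Q′_□(Ṽ) ∘ Ω₀ = res♯ ∘ Q′_□(Ṽ)`, `Ω₀ ∘ Q′*_□(Ṽ) ∘ ext♯ = Q′*_□(Ṽ) ∘ ext♯`;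
* §3 ★★★ `word_at` : `QcR Ṽ ∘ (conj b(η²(padΔ(Ṽ))⁻¹)·conj b(η²(padΔ(Ṽ))⁻¹)) ∘ QcsR Ṽ = conj b (η⁴·(res♯ ∘ XCubeGY i □ 𝔭 (GpDirY … Ω₀) Ṽ ∘ ext♯)|_ℝ)`.
With FILE `B9Cor35CDirPaddedCarrier.eq_CinvR_of_laws` this turns the engine's `Tinv` into def-Y's `CinvR Ṽ`.

## Status

Printed-statement pass + proof body (proof-backed; a port in the tree's vocabulary; operator algebra): [Balaban1985BackgroundPropagators] pp. 394, 403, 409,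
re-read 2026-08-31.  Honest label: bookkeeping; no estimate.  Node N06 of the `pub-ymgap` DAG is NOT discharged here and the Yang–Mills mass gap is NOT
proved here.  NEW file; nothing landed is modified.  No `sorry`, no `axiom`, no `instance`, no `notation`.  Net new unproved facts: 0.  Cell `pub-ymgap`
(HUMAN RULING D-0062), node N06 [B9], seat `pub-ymgap-dag-n06-c` (g33), 2026-08-31.
RELATED, NOT DUPLICATED (searched 2026-08-31: `rg 'ringInverse_padDeltaCubeY_eq_add|resOp_comp_QpCubeY_comp_cubeProjY|word_at'` = ∅): UNIT 1
`B9Cor35GpDirInputsAtOne.GpDirPadW_eq_add` (the `U = 1` matrix form), FILE `B9Cor35CDirCarrierAtOne.word_one` (the `U = 1` word).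
-/

noncomputable section

namespace Literature.MathematicalPhysics.QuantumFieldTheory.Balaban1983to89.B9Cor35CDirWordAtField

open B6KLevelCensusIndexV1 (KIdx kGeo)
open B6Cover236MultiLevelBlocks (cubes)
open B6Geom246MultiLevelBoxL0 (blkOf)
open B9Eq39Adjoint (R R_zero)
open B9Eq352DivFormLetters (conj)
open B9Eq376POneLetters (conjHom conjHom_comp conjHom_eq_conj)
open B9CubeLettersOpsL0 (cubeFamY deltaPrimeACubeY)
open B9CubeLettersBondOpsL0 (BlkCubeY QpCubeY QpsCubeY)
open B9Cor35GpCubeInputsAtOne (eta_ne_zero)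
open B9Cor36CubeSandwichQ (QpCubeY_apply_eq_zero_of QpsCubeY_apply)
open B9Cor35GpDirInputsAtOne (dirDomY)
open B9Cor35CDirCarrierAtOne (resMatY extMatY SBlk QcR QcsR)
open B9Cor35CDirPaddedCarrier (resOp extOp mem_SBlk_of_mem)
open Node00 (SiteY CfgY toKT liftMatY liftMatY_apply)
open Node00.OpsYLocalInverse (dirPadY dirInvY cubeProjY cubeProjY_apply cubeProjY_mul_cubeProjY mul_dirPadY dirPadY_mul)
open Node00.OpsYCubeDirInverse (GpDirY GpDirY_def padDeltaCubeY)
open Node00.OpsYCubeKnitPar (parKnitCubeY)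
open Node00.OpsYCubeProjectionG (insideBlkY mem_insideBlkY_iff XCubeGY)
open scoped Matrix

variable {d ℓ : ℕ} {hd : 1 ≤ d + 1} {hL : Odd (ℓ + 1) ∧ 1 < ℓ + 1} {b₀ b₁ : ℝ}
variable {𝔸 : Type} [NormedRing 𝔸] [NormedAlgebra ℂ 𝔸] [CompleteSpace 𝔸]
variable {ι : Type} [Fintype ι] (b : Module.Basis ι ℝ 𝔸)
variable (i : KIdx d ℓ hd hL b₀ b₁) (c : ↥(cubes (toKT i).D.toDomains))

/-! ## §1 The padded site inverse splits: `(padΔ_{□,Ω₀}(Ṽ))⁻¹ = G′_□(Ṽ) + (1 − Ω₀)` -/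

/-- ★ **`Ring.inverse (padΔ_{□,Ω₀}(Ṽ)) = G′_□(Ṽ) + (1 − Ω₀)`** whenever the padded operator is a unit (it commutes with `Ω₀` and is the identity on the range
of `1 − Ω₀`). [cite: Balaban1985BackgroundPropagators, p.394 («Δ′_a↾Ω₀ = Ω₀Δ′_aΩ₀ … Its inverse is denoted by G′»), p.409 l.1–5] -/
theorem ringInverse_padDeltaCubeY_eq_add (V : CfgY 𝔸 i) (hunit : IsUnit (padDeltaCubeY i c (parKnitCubeY i c) (dirDomY i c) V)) :
    Ring.inverse (padDeltaCubeY i c (parKnitCubeY i c) (dirDomY i c) V) =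
      GpDirY i c (parKnitCubeY i c) (dirDomY i c) V + (1 - cubeProjY i (dirDomY i c)) := by
  set P : Module.End ℂ (SiteY i → 𝔸) := cubeProjY i (dirDomY i c) with hPdef
  set pad := padDeltaCubeY i c (parKnitCubeY i c) (dirDomY i c) V with hpad
  have hP2 : P * P = P := cubeProjY_mul_cubeProjY i _
  have hpadP : pad = dirPadY P (deltaPrimeACubeY i c (parKnitCubeY i c) V) := rfl
  -- `pad` commutes with `Ω₀` and fixes the range of `1 − Ω₀`
  have hcomm : P * pad = pad * P := by rw [hpadP, mul_dirPadY hP2, dirPadY_mul hP2]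
  have hEE : (1 - P) * (1 - P) = 1 - P := by rw [sub_mul, one_mul, mul_sub, mul_one, hP2, sub_self, sub_zero]
  have hfix : pad * (1 - P) = 1 - P := by
    rw [hpadP, dirPadY, add_mul, hEE, mul_sub, mul_one, mul_assoc (P * deltaPrimeACubeY i c (parKnitCubeY i c) V) P P, hP2, sub_self, zero_add]
  have hRP : Ring.inverse pad * P = P * Ring.inverse pad := by
    calc Ring.inverse pad * P = Ring.inverse pad * P * (pad * Ring.inverse pad) := by rw [Ring.mul_inverse_cancel _ hunit, mul_one]
      _ = Ring.inverse pad * (P * pad) * Ring.inverse pad := by simp only [mul_assoc]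
      _ = Ring.inverse pad * (pad * P) * Ring.inverse pad := by rw [hcomm]
      _ = P * Ring.inverse pad := by rw [← mul_assoc, Ring.inverse_mul_cancel _ hunit, one_mul]
  have hRE : Ring.inverse pad * (1 - P) = 1 - P := by
    calc Ring.inverse pad * (1 - P) = Ring.inverse pad * (pad * (1 - P)) := by rw [hfix]
      _ = 1 - P := by rw [← mul_assoc, Ring.inverse_mul_cancel _ hunit, one_mul]
  rw [GpDirY_def, ← hpad]
  calc Ring.inverse pad = Ring.inverse pad * P + Ring.inverse pad * (1 - P) := by rw [← mul_add, add_sub_cancel, mul_one]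
    _ = P * Ring.inverse pad * P + (1 - P) := by rw [hRE, ← hRP, mul_assoc, hP2]

/-! ## §2 The knit-cube averaging letters only see `Ω₀(□)` from the carrier -/

omit [CompleteSpace 𝔸] in
/-- `res♯`, evaluated. [cite: Balaban1985BackgroundPropagators, p.394, bookkeeping] -/
theorem resOp_apply (ω : BlkCubeY i c → 𝔸) (v : ↥(SBlk i c)) : resOp (SBlk i c) ω v = ω v.1 := by
  rw [resOp, liftMatY_apply]
  simp only [resMatY, apply_ite Complex.ofReal, Complex.ofReal_one, Complex.ofReal_zero, ite_smul, one_smul, zero_smul, Finset.sum_ite_eq,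
    Finset.mem_univ, if_true]

omit [CompleteSpace 𝔸] in
/-- `ext♯`, evaluated. [cite: Balaban1985BackgroundPropagators, p.394, bookkeeping] -/
theorem extOp_apply (ω : ↥(SBlk i c) → 𝔸) (s : BlkCubeY i c) : extOp (SBlk i c) ω s = if h : s ∈ SBlk i c then ω ⟨s, h⟩ else 0 := by
  rw [extOp, liftMatY_apply]
  by_cases hs : s ∈ SBlk i c
  · rw [dif_pos hs, Finset.sum_eq_single (⟨s, hs⟩ : ↥(SBlk i c))]
    · simp only [extMatY, if_true, Complex.ofReal_one, one_smul]
    · intro v _ hv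
      have : s ≠ (v : BlkCubeY i c) := fun h => hv (Subtype.ext h.symm)
      simp only [extMatY, if_neg this, Complex.ofReal_zero, zero_smul]
    · intro h; exact absurd (Finset.mem_univ _) h
  · rw [dif_neg hs]
    refine Finset.sum_eq_zero fun v _ => ?_
    have : s ≠ (v : BlkCubeY i c) := fun h => hs (h ▸ v.2)
    simp only [extMatY, if_neg this, Complex.ofReal_zero, zero_smul]

/-- ★ `res♯ ∘ Q′_□(Ṽ) ∘ Ω₀ = res♯ ∘ Q′_□(Ṽ)` (a block inside `Ω₀(□)` only averages sites of `Ω₀(□)`). [cite: Balaban1985BackgroundPropagators, (3.21) p.394, p.409 l.1–5] -/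
theorem resOp_QpCubeY_cubeProjY (V : CfgY 𝔸 i) :
    resOp (SBlk i c) ∘ₗ QpCubeY i c (parKnitCubeY i c) V ∘ₗ cubeProjY i (dirDomY i c) = resOp (SBlk i c) ∘ₗ QpCubeY i c (parKnitCubeY i c) V := by
  refine LinearMap.ext fun Λ => funext fun v => ?_
  simp only [LinearMap.comp_apply, resOp_apply]
  rw [← sub_eq_zero, ← Pi.sub_apply, ← map_sub]
  refine QpCubeY_apply_eq_zero_of i c (parKnitCubeY i c) V _ v.1 fun z hz => ?_
  rw [Pi.sub_apply, cubeProjY_apply, if_pos ((mem_insideBlkY_iff i c _ _).1 v.2 z hz), sub_self]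

/-- ★ `Ω₀ ∘ Q′*_□(Ṽ) ∘ ext♯ = Q′*_□(Ṽ) ∘ ext♯` (a block function supported in `𝔖` spreads to sites of `Ω₀(□)` only). [cite: Balaban1985BackgroundPropagators, (3.24)–(3.25) p.394, p.409 l.1–5] -/
theorem cubeProjY_QpsCubeY_extOp (V : CfgY 𝔸 i) :
    cubeProjY i (dirDomY i c) ∘ₗ QpsCubeY i c (parKnitCubeY i c) V ∘ₗ extOp (SBlk i c) = QpsCubeY i c (parKnitCubeY i c) V ∘ₗ extOp (SBlk i c) := by
  refine LinearMap.ext fun ω => funext fun z => ?_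
  simp only [LinearMap.comp_apply, cubeProjY_apply]
  split_ifs with hz
  · rfl
  · rw [QpsCubeY_apply, extOp_apply, dif_neg, R_zero]
    intro hs
    exact hz ((mem_insideBlkY_iff i c _ _).1 hs z rfl)

/-! ## §3 ★★★ The block word on the carrier at the field `Ṽ` -/

/-- ★★★ **THE DIRICHLET BLOCK WORD ON THE CARRIER AT ANY FIELD**: with `padΔ_{□,Ω₀}(Ṽ)` a unit,
`QcR Ṽ ∘ (conj b(η²(padΔ(Ṽ))⁻¹)·conj b(η²(padΔ(Ṽ))⁻¹)) ∘ QcsR Ṽ = conj b (η⁴·(res♯ ∘ X_□(Ṽ) ∘ ext♯)|_ℝ)`, `X_□(Ṽ) = XCubeGY i □ 𝔭 (GpDirY … Ω₀(□)) Ṽ`.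
[cite: Balaban1985BackgroundPropagators, (3.21)∕(3.25) pp.394–395, p.409 l.1–5, Thm 3.4 p.400; Balaban1984PropagatorsII, (2.52) p.232] -/
theorem word_at (V : CfgY 𝔸 i) (hunit : IsUnit (padDeltaCubeY i c (parKnitCubeY i c) (dirDomY i c) V)) :
    QcR b i c V ∘ₗ
        (conj b (((kGeo i).eta ^ 2) • (Ring.inverse (padDeltaCubeY i c (parKnitCubeY i c) (dirDomY i c) V)).restrictScalars ℝ) *
         conj b (((kGeo i).eta ^ 2) • (Ring.inverse (padDeltaCubeY i c (parKnitCubeY i c) (dirDomY i c) V)).restrictScalars ℝ)) ∘ₗ QcsR b i c V =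
      conj b (((kGeo i).eta ^ 4) • (resOp (SBlk i c) ∘ₗ XCubeGY i c (parKnitCubeY i c) (GpDirY i c (parKnitCubeY i c) (dirDomY i c)) V ∘ₗ
        extOp (SBlk i c)).restrictScalars ℝ) := by
  set P : Module.End ℂ (SiteY i → 𝔸) := cubeProjY i (dirDomY i c) with hPdef
  set G : Module.End ℂ (SiteY i → 𝔸) := GpDirY i c (parKnitCubeY i c) (dirDomY i c) V with hGdef
  have hP2 : P * P = P := cubeProjY_mul_cubeProjY i _
  have hPG : P * G = G := by rw [hGdef, GpDirY_def, ← mul_assoc, ← mul_assoc, hP2]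
  have hGP : G * P = G := by rw [hGdef, GpDirY_def, mul_assoc, hP2]
  -- `(padΔ)⁻¹·(padΔ)⁻¹ = G·G + (1 − Ω₀)`
  have hsq : Ring.inverse (padDeltaCubeY i c (parKnitCubeY i c) (dirDomY i c) V) * Ring.inverse (padDeltaCubeY i c (parKnitCubeY i c) (dirDomY i c) V) =
      G * G + (1 - P) := by
    rw [ringInverse_padDeltaCubeY_eq_add i c V hunit, ← hGdef, ← hPdef]
    have hGE : G * (1 - P) = 0 := by rw [mul_sub, mul_one, hGP, sub_self]
    have hEG : (1 - P) * G = 0 := by rw [sub_mul, one_mul, hPG, sub_self]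
    have hEE : (1 - P) * (1 - P) = 1 - P := by rw [sub_mul, one_mul, mul_sub, mul_one, hP2, sub_self, sub_zero]
    rw [add_mul, mul_add, mul_add, hGE, hEG, hEE, add_zero, zero_add]
  -- the ℂ-linear composite
  have hC : (resOp (SBlk i c) ∘ₗ QpCubeY i c (parKnitCubeY i c) V) ∘ₗ
      ((Ring.inverse (padDeltaCubeY i c (parKnitCubeY i c) (dirDomY i c) V) * Ring.inverse (padDeltaCubeY i c (parKnitCubeY i c) (dirDomY i c) V)) ∘ₗ
        (QpsCubeY i c (parKnitCubeY i c) V ∘ₗ extOp (SBlk i c))) =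
      resOp (SBlk i c) ∘ₗ XCubeGY i c (parKnitCubeY i c) (GpDirY i c (parKnitCubeY i c) (dirDomY i c)) V ∘ₗ extOp (SBlk i c) := by
    rw [hsq, LinearMap.add_comp, LinearMap.comp_add]
    -- the padding term vanishes: `res♯Q′(1 − Ω₀) = 0`
    have hE : (resOp (SBlk i c) ∘ₗ QpCubeY i c (parKnitCubeY i c) V) ∘ₗ ((1 - P) ∘ₗ (QpsCubeY i c (parKnitCubeY i c) V ∘ₗ extOp (SBlk i c))) = 0 := by
      rw [← LinearMap.comp_assoc, LinearMap.comp_sub, Module.End.one_eq_id, LinearMap.comp_id, hPdef, LinearMap.comp_assoc (cubeProjY i (dirDomY i c)),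
        resOp_QpCubeY_cubeProjY, sub_self, LinearMap.zero_comp]
    rw [hE, add_zero, XCubeGY, ← hGdef, Module.End.mul_eq_comp]
    simp only [LinearMap.comp_assoc]
  rw [QcR, QcsR, ← B9Eq352DivFormLetters.conj_mul, smul_mul_smul_comm, ← conjHom_eq_conj, conjHom_comp, conjHom_comp, ← conjHom_eq_conj]
  congr 1
  rw [Module.End.mul_eq_comp, LinearMap.smul_comp, LinearMap.comp_smul, ← pow_add]
  congr 1
  have hrs : ((Ring.inverse (padDeltaCubeY i c (parKnitCubeY i c) (dirDomY i c) V)).restrictScalars ℝ ∘ₗ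
      (Ring.inverse (padDeltaCubeY i c (parKnitCubeY i c) (dirDomY i c) V)).restrictScalars ℝ : Module.End ℝ (SiteY i → 𝔸)) =
      (Ring.inverse (padDeltaCubeY i c (parKnitCubeY i c) (dirDomY i c) V) * Ring.inverse (padDeltaCubeY i c (parKnitCubeY i c) (dirDomY i c) V)).restrictScalars ℝ := by
    rw [Module.End.mul_eq_comp]; rfl
  rw [hrs]
  exact congrArg (LinearMap.restrictScalars ℝ) hC

end Literature.MathematicalPhysics.QuantumFieldTheory.Balaban1983to89.B9Cor35CDirWordAtField
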